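import Literature.AnabelianGeometry.SemiGraphs.PSCSmoothCurveShape
import Literature.AnabelianGeometry.AbsoluteAnabelian.FreeProlCyclicEncoding
import Literature.GroupTheory.CombinatorialGroupTheory.PuncturedSurfaceGroupElevationQuotients
import HarnessLib

/-!
# Cusp inertia in a pro-`Σ` completion of `Γ_{g,r}` is free pro-`Σ`-cyclic (`Π_e ≅ Ẑ^Σ`), every `Σ`

[CombGC] Rmk 1.1.3 (bib `MochizukiCombGC2007`, p. 7: the edge-like subgroups of a PSC-fundamental
group are `≅ Ẑ^Σ`), [AbsTopII] Prop 1.3 (i) p. 11 («if `e` is a cusp of `𝔾`, then as abstract profinite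
groups, `I_e ≅ Ẑ^Σ`»; bib `MochizukiAbsTopII2013`), [SemiAnbd] Ex. 2.10 p. 31 (the vertex groups of the
semi-graph of anabelioids of a pointed stable curve are pro-`Σ` completions of hyperbolic punctured surface
groups `Γ_{g,r}`, the branch groups the closed cusp inertia subgroups).

The cell types «`≅ Ẑ^Σ`» INTRINSICALLY (abc-iut-L4-t6's `AbsTopII.IsFreeProSigmaCyclic Σ`: a dense cyclic
subgroup; the indices of the open subgroups are exactly the `Σ`-integers).  For the closed cusp inertia
subgroup `A := closure ι⟨c_j⟩` of a profinite pro-`Σ` completion `ι : Γ_{g,r} → P` of a HYPERBOLIC type the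
tree so far knows: `A` is infinite (`infinite_cuspInertia_closure`, abc-iut-L5-t9), malnormal and
commensurably terminal (abc-iut-w5-d016 / w5-d051 / `ProSigmaCuspInertiaMalnormalHolds.lean`), and — for
`Σ = {l}` ONLY — free pro-`{l}`-cyclic by the encoding lemma
`isFreeProSigmaCyclic_singleton_of_topologicalClosure_zpowers_eq` (infinite + pro-`l` suffices).  For a
general `Σ` infinitude is not enough (`ℤ_p × finite`), and the input is abc-iut-L3-t4's UNIFORM CUSP-ORDER
QUOTIENTS (`PuncturedSurfaceGroup.exists_hom_cuspOrder`: for every `n ≥ 1` a finite quotient of order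
dividing `n³` in which every `c_j` has order EXACTLY `n`).  This PROOF-ONLY file (no definitions) proves:

* `isFreeProSigmaCyclic_cuspInertia_closure` — **`closure ι⟨c_j⟩` is free pro-`Σ`-cyclic for EVERY
  nonempty set of primes `Σ`**: `⟨ι c_j⟩` is dense in it; an open subgroup has `Σ`-integer index
  (`isSigmaInteger_index_of_isOpen_of_isProSigma`); and for a `Σ`-integer `n` the kernel of the uniform
  cusp-order quotient is the pull-back of an open `U ≤ P` (`IsProSigmaCompletion.comap_surj`), and
  `[A : A ∩ U] = n` exactly — `A/(A ∩ U)` is generated by the image of the dense generator, whose order is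
  the order `n` of `c_j` in the quotient;
* `PSCDatum.isFreeProSigmaCyclic_cuspGp_of_smoothCurve` — the same in layer L3's vocabulary: at a PSC
  datum of SMOOTH-CURVE SHAPE (`PSCSmoothCurveShape.lean`) every cuspidal subgroup is free
  pro-`Σ_G`-cyclic — [CombGC] Rmk 1.1.3 for cusps at these data, the hypothesis shape
  `∀ c, IsFreeProSigmaCyclic G.Sigma ↥(G.cuspGp c)` consumed by the [AbsTopII] Prop 1.3 (i) bridges
  (abc-iut-f-069 `prop_1_3_i_ofEmbedding`; FACT-LIST F-0297 instance forms; removes the `Σ = {l}`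
  restriction of `InertiaGroupsCuspidalOfPSC.lean`).

Classical combinatorial / profinite group theory; theorems only; no side taken on [IUTchIII] Cor 3.12.
-/

namespace Literature.AnabelianGeometry.SemiGraphs

open Literature.GroupTheory.CombinatorialGroupTheory
open Literature.AnabelianGeometry.Anabelioids (IsSigmaInteger)
open Literature.AnabelianGeometry.AbsoluteAnabelian (AbsTopII.IsFreeProSigmaCyclic)
open scoped Pointwise

universe v

namespace SemiGraphOfAnabelioids

variable {Sigma : Set ℕ} {g r : ℕ} {P : Type v} [Group P] [TopologicalSpace P] [IsTopologicalGroup P]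
  [CompactSpace P] [T2Space P] [TotallyDisconnectedSpace P]

/-- **Cusp inertia in a pro-`Σ` completion of a hyperbolic `Γ_{g,r}` is free pro-`Σ`-cyclic** («as
abstract profinite groups, `I_e ≅ Ẑ^Σ`», [AbsTopII] Prop 1.3 (i); [CombGC] Rmk 1.1.3), for EVERY nonempty
set `Σ` (no primality or nonemptiness needed): the closure `A` of `ι⟨c_j⟩` has the dense cyclic subgroup `⟨ι c_j⟩`, its open subgroups
have `Σ`-integer index, and for every `Σ`-integer `n` the trace on `A` of the open pull-back of abc-iut-L3-t4's
uniform cusp-order quotient (`exists_hom_cuspOrder`: `c_j ↦` an element of order exactly `n`) is an open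
subgroup of index exactly `n`. [cite: MochizukiAbsTopII2013, Prop 1.3 (i) p.11]
[cite: MochizukiCombGC2007, Rmk 1.1.3 p.7] [cite: MochizukiSemiAnbd2006, Ex. 2.10 p.31] -/
theorem isFreeProSigmaCyclic_cuspInertia_closure
    (h : PuncturedSurfaceGroup.IsHyperbolicType g r) (ι : PuncturedSurfaceGroup g r →* P)
    (hι : IsProSigmaCompletion Sigma ι) (j : Fin r) :
    AbsTopII.IsFreeProSigmaCyclic Sigma
      ↥((PuncturedSurfaceGroup.cuspInertia (g := g) j).map ι).topologicalClosure := by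
  classical
  set A := ((PuncturedSurfaceGroup.cuspInertia (g := g) j).map ι).topologicalClosure with hA_def
  set x : P := ι (PuncturedSurfaceGroup.c j) with hx_def
  have hK : (PuncturedSurfaceGroup.cuspInertia (g := g) j).map ι = Subgroup.zpowers x := by
    rw [PuncturedSurfaceGroup.cuspInertia, MonoidHom.map_zpowers]
  have hA : (Subgroup.zpowers x).topologicalClosure = A := by rw [hA_def, hK]
  have hP : IsProSigma Sigma P :=
    ⟨fun U _ p hp hdvd => (hι.index_open U.toSubgroup inferInstance U.isOpen').2 p hp hdvd⟩
  -- the dense generator `a = ι c_j ∈ A`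
  have hxA : x ∈ A := hA ▸ Subgroup.le_topologicalClosure _ (Subgroup.mem_zpowers x)
  set a : ↥A := ⟨x, hxA⟩ with ha_def
  have hval : ((↑) : ↥A → P) '' (Subgroup.zpowers a : Set ↥A) = (Subgroup.zpowers x : Set P) := by
    have hmap := congrArg SetLike.coe (MonoidHom.map_zpowers A.subtype a)
    rw [Subgroup.coe_map] at hmap
    exact hmap
  have hdense : Dense (Subgroup.zpowers a : Set ↥A) := by
    rw [dense_iff_closure_eq, Topology.IsEmbedding.subtypeVal.closure_eq_preimage_closure_image,
      hval, ← Subgroup.topologicalClosure_coe, hA]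
    exact Subtype.coe_preimage_self _
  -- `A` is abelian
  have hcomm : ∀ u v : ↥((PuncturedSurfaceGroup.cuspInertia (g := g) j).map ι), u * v = v * u := by
    rintro ⟨u, hu⟩ ⟨v, hv⟩
    rw [hK] at hu hv
    obtain ⟨k, rfl⟩ := Subgroup.mem_zpowers_iff.mp hu
    obtain ⟨l, rfl⟩ := Subgroup.mem_zpowers_iff.mp hv
    exact Subtype.ext (zpow_mul_comm x k l)
  letI : CommGroup ↥A := Subgroup.commGroupTopologicalClosure _ hcomm
  refine ⟨⟨a, hdense⟩, fun n => ⟨?_, fun hn => ?_⟩⟩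
  · rintro ⟨H, hHo, rfl⟩
    exact AbsoluteAnabelian.isSigmaInteger_index_of_isOpen_of_isProSigma hP A H hHo
  -- a finite quotient of `Γ_{g,r}` in which `c_j` has order exactly `n`; its kernel has `Σ`-integer index
  obtain ⟨B, _, _, f, hcard, hord⟩ := PuncturedSurfaceGroup.exists_hom_cuspOrder (g := g) h hn.1
  have hn3 : IsSigmaInteger Sigma (n ^ 3) := by
    rw [pow_succ, pow_two]
    exact (hn.mul hn).mul hn
  have hidx : IsSigmaInteger Sigma f.ker.index :=
    hn3.of_dvd ((PuncturedSurfaceGroup.index_ker_dvd_card f).trans hcard)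
  -- so the kernel is the pull-back of an open subgroup `U` of the completion
  obtain ⟨U, hUo, hUN⟩ := hι.comap_surj f.ker inferInstance hidx
  have hpow : ∀ m : ℕ, x ^ m ∈ U ↔ n ∣ m := by
    intro m
    rw [hx_def, ← map_pow, ← Subgroup.mem_comap, hUN, MonoidHom.mem_ker, map_pow, ← hord j]
    exact orderOf_dvd_iff_pow_eq_one.symm
  -- `H := A ∩ U`, open in `A`
  let H : Subgroup ↥A := U.subgroupOf A
  have hHo : IsOpen (H : Set ↥A) := hUo.preimage continuous_subtype_val
  haveI : H.Normal := ⟨fun m hm y => by rwa [mul_comm y m, mul_inv_cancel_right]⟩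
  have hmemH : ∀ m : ℕ, a ^ m ∈ H ↔ n ∣ m := fun m => by
    rw [Subgroup.mem_subgroupOf, Subgroup.coe_pow]
    exact hpow m
  refine ⟨H, hHo, ?_⟩
  -- the image of `a` in `A ⧸ H` has order `n` …
  have horder : orderOf (QuotientGroup.mk (s := H) a) = n := by
    refine (orderOf_eq_iff hn.1).mpr ⟨?_, fun m hm hm0 hm1 => ?_⟩
    · rw [← QuotientGroup.mk_pow, QuotientGroup.eq_one_iff]
      exact (hmemH n).mpr dvd_rfl
    · rw [← QuotientGroup.mk_pow, QuotientGroup.eq_one_iff, hmemH] at hm1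
      exact absurd (Nat.le_of_dvd hm0 hm1) (not_le.mpr hm)
  -- … and generates `A ⧸ H`: every coset `b H` is open, hence contains a power of the dense generator
  have hgen : Subgroup.zpowers (QuotientGroup.mk (s := H) a) = ⊤ := by
    rw [eq_top_iff]
    rintro q -
    obtain ⟨b, rfl⟩ := QuotientGroup.mk_surjective q
    obtain ⟨y, hy, hyb⟩ := hdense.exists_mem_open (hHo.leftCoset b) ⟨b * 1, mem_leftCoset b H.one_mem⟩
    have hq : (QuotientGroup.mk b : ↥A ⧸ H) = QuotientGroup.mk y :=
      QuotientGroup.eq.mpr ((mem_leftCoset_iff b).mp hyb)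
    obtain ⟨k, rfl⟩ := Subgroup.mem_zpowers_iff.mp hy
    rw [hq, QuotientGroup.mk_zpow]
    exact ⟨k, rfl⟩
  calc H.index = Nat.card (↥A ⧸ H) := H.index_eq_card
    _ = Nat.card (⊤ : Subgroup (↥A ⧸ H)) := Subgroup.card_top.symm
    _ = Nat.card (Subgroup.zpowers (QuotientGroup.mk (s := H) a)) := by rw [hgen]
    _ = orderOf (QuotientGroup.mk (s := H) a) := Nat.card_zpowers _
    _ = n := horder

end SemiGraphOfAnabelioids

namespace PSCDatum

variable {Sigma : Set ℕ} {g r : ℕ} {P : Type v} [Group P] [TopologicalSpace P] [IsTopologicalGroup P]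
  [CompactSpace P] [T2Space P] [TotallyDisconnectedSpace P]

/-- **[CombGC] Rmk 1.1.3 for cusps at PSC data of smooth-curve shape**: if the cuspidal subgroups of
`G` are the closed cusp inertia subgroups of a profinite pro-`Σ_G` completion of a hyperbolic `Γ_{g,r}`
(`PSCSmoothCurveShape.lean`), then every `Π_c` is free pro-`Σ_G`-cyclic («`Π_e ≅ Ẑ^Σ`») — the input
`∀ c, IsFreeProSigmaCyclic G.Sigma ↥(G.cuspGp c)` of the [AbsTopII] Prop 1.3 (i) bridges, for every `Σ`.
[cite: MochizukiCombGC2007, Rmk 1.1.3 p.7] [cite: MochizukiAbsTopII2013, Prop 1.3 (i) p.11] -/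
theorem isFreeProSigmaCyclic_cuspGp_of_smoothCurve (G : PSCDatum P)
    (h : PuncturedSurfaceGroup.IsHyperbolicType g r) (ι : PuncturedSurfaceGroup g r →* P)
    (hι : SemiGraphOfAnabelioids.IsProSigmaCompletion G.Sigma ι) (e : G.graph.C ≃ Fin r)
    (hC : ∀ c, G.cuspGp c =
      ((PuncturedSurfaceGroup.cuspInertia (g := g) (e c)).map ι).topologicalClosure) (c : G.graph.C) :
    AbsTopII.IsFreeProSigmaCyclic G.Sigma ↥(G.cuspGp c) := by
  rw [hC c]
  exact SemiGraphOfAnabelioids.isFreeProSigmaCyclic_cuspInertia_closure h ι hι (e c)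

end PSCDatum

end Literature.AnabelianGeometry.SemiGraphs
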